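import Literature.MathematicalPhysics.QuantumLattice.SectorPropagatorSupBound
import Literature.Analysis.Fourier.FourierLinearChange
import Mathlib.MeasureTheory.Measure.Haar.InnerProductSpace
import HarnessLib

/-!
# The sector propagator as a Fourier transform; the anisotropic chart and the decay transfer
(Benfatto–Giuliani–Mastropietro 2006, Lemma 2.2: the change of variables)

Topic `Literature/MathematicalPhysics/QuantumLattice`; continues `SectorPropagatorSupBound.lean`
(`sectorSymbol`, `sectorPropagator e₀ μ n ω x₀ x⃗ = ∫ e^{i(k⃗·x⃗ - k₀x₀)} sectorSymbol`).
BGM 2006, Lemma 2.2 (2.52): `|g^{(h)}_ω(x)| ≤ C_N γ^{(3/2)h} (1 + (γ^h|x₀| + γ^h|x'₁|)^N + γ^{hN/2}|x'₂|^N)^{-1}`,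
`x'₁ = x⃗·n(θ_{h,ω})`, `x'₂ = x⃗·τ(θ_{h,ω})`; the proof is the anisotropic change of variables
`k = p_F(θ_{h,ω}) + γ^h t₁ n + γ^{h/2} t₂ τ`, `k₀ = γ^h t₀` (volume `γ^{5h/2} = γ^h·γ^h·γ^{h/2}`,
dual variables `(γ^h x₀, γ^h x'₁, γ^{h/2} x'₂)`) followed by integration by parts in `t`. This
file PROVES the change-of-variables half, reducing Lemma 2.2 to an `h`-UNIFORM Fourier-decay
estimate for the rescaled symbol:

* `splitMomentum : ℝ³ ≃ᵐ ℝ × ℝ²` (measure preserving) and `sectorSymbolE = sectorSymbol ∘ split`;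
* `sectorPropagator_eq_fourier` — `g(x₀, x⃗) = 𝓕(sectorSymbolE)(ξ)` at the dual point
  `ξ = (x₀, -x⃗)/(2π)` (`dualPoint`), for Mathlib's `𝓕f(ξ) = ∫ e^{-2πi⟨v,ξ⟩} f(v) dv` on `ℝ³`;
* `sectorChart μ θ₀ n : ℝ³ ≃L[ℝ] ℝ³`, `t ↦ (4^{-n}t₀, 4^{-n}t₁ n(θ₀) + 2^{-n}t₂ τ(θ₀))`, with
  `det = 4^{-n}·4^{-n}·2^{-n}` (`det_sectorChart`, the `γ^h γ^h γ^{h/2}` of BGM) and adjoint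
  `w ↦ (4^{-n}w₀, 4^{-n}⟨n, w⃗⟩, 2^{-n}⟨τ, w⃗⟩)` (`sectorChartAdj`, `adjoint_sectorChart`: the dual
  scales);
* `rescaledSectorSymbol e₀ μ n ω t = sectorSymbolE(q_F + sectorChart t)`, `q_F = (0, p_F(θ_{h,ω}))`;
* **`norm_sectorPropagator_le_of_fourier_decay`** — if `‖𝓕(rescaledSectorSymbol)(y)‖ ≤ K(1+‖y‖)^{-N}`
  for all `y` then for all `x`,
  `|g^{(h)}_ω(x)| ≤ 4^{-n}4^{-n}2^{-n} · K · (1 + ‖(4^{-n}x₀, 4^{-n}x⃗·n, 2^{-n}x⃗·τ)‖/(2π))^{-N}`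
  (translation by `q_F` is a phase; `Analysis/Fourier/FourierLinearChange`). With
  `K = O(γ^{-h})` — the content of the remaining half of Lemma 2.2, the `h`-uniform symbol
  estimates — this is (2.52).

Everything is PROVED; the definitions are the split, the dual point, the chart and its adjoint,
and the rescaled symbol.

## Sources

* G. Benfatto, A. Giuliani, V. Mastropietro, Ann. Henri Poincaré 7 (2006) 809–898, §2.5
  Lemma 2.2 (2.51)–(2.52) (arXiv:cond-mat/0507686 p. 11). [BenfattoGiulianiMastropietro2006]
* G. Benfatto, A. Giuliani, V. Mastropietro, Ann. Henri Poincaré 4 (2003) 137–193, §7.2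
  (proof of Lemma 3.1: "using simple integration by parts arguments"). [BenfattoGiulianiMastropietro2003]
-/

noncomputable section

open Real Set MeasureTheory Complex
open scoped Topology ENNReal FourierTransform InnerProductSpace

namespace Literature.MathematicalPhysics.QuantumLattice

/-- Momentum space `ℝ³ = ℝ_{k₀} × ℝ²_{k⃗}` as a Euclidean space (`EuclideanSpace ℝ (Fin 3)`). [folklore] -/
abbrev MomSpace : Type := EuclideanSpace ℝ (Fin 3)

/-! ### Splitting off `k₀` -/

/-- `ℝ³ ≃ᵐ ℝ × ℝ²`, `q ↦ (q₀, (q₁, q₂))` (the same construction as `Regev2004.splitFirst`, kept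
local to avoid importing the lattice files). [folklore] -/
def splitMomentum : MomSpace ≃ᵐ ℝ × (Fin 2 → ℝ) :=
  (MeasurableEquiv.toLp 2 (Fin 3 → ℝ)).symm.trans (MeasurableEquiv.piFinSuccAbove (fun _ => ℝ) 0)

/-- `splitMomentum q = (q₀, (q₁, q₂))`. [folklore] -/
theorem splitMomentum_apply (q : MomSpace) : splitMomentum q = (q 0, ![q 1, q 2]) := by
  have h : splitMomentum q = (q 0, fun j : Fin 2 => q j.succ) := by
    simp [splitMomentum, MeasurableEquiv.trans_apply, MeasurableEquiv.piFinSuccAbove_apply]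
    rfl
  rw [h]
  congr 1
  funext j
  fin_cases j <;> rfl

/-- `splitMomentum` is measure preserving. [folklore] -/
theorem measurePreserving_splitMomentum : MeasurePreserving splitMomentum volume volume :=
  (EuclideanSpace.volume_preserving_symm_measurableEquiv_toLp (Fin 3)).trans
    (volume_preserving_piFinSuccAbove (fun _ => ℝ) 0)

/-- The sector symbol on `ℝ³`. [cite: BenfattoGiulianiMastropietro2006, §2.5 (2.49)] -/
def sectorSymbolE (e₀ μ : ℝ) (n : ℕ) (ω : ℤ) : MomSpace → ℂ := fun q => sectorSymbol e₀ μ n ω (splitMomentum q)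

/-- The dual point `ξ(x₀, x⃗) = (x₀, -x₁, -x₂)/(2π)` at which Mathlib's Fourier transform
reproduces the kernel `e^{i(k⃗·x⃗ - k₀x₀)}`. [folklore] -/
def dualPoint (x₀ : ℝ) (x : Fin 2 → ℝ) : MomSpace :=
  WithLp.toLp 2 ![x₀ / (2 * π), -x 0 / (2 * π), -x 1 / (2 * π)]

/-- Inner products in `ℝ³` in coordinates. [folklore] -/
theorem inner_E3 (q w : MomSpace) : ⟪q, w⟫_ℝ = q 0 * w 0 + q 1 * w 1 + q 2 * w 2 := by
  simp [PiLp.inner_apply, Fin.sum_univ_three, mul_comm]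

/-- **The sector propagator is a Fourier transform**: `g(x₀, x⃗) = 𝓕(sectorSymbolE)(ξ(x₀, x⃗))`.
[cite: BenfattoGiulianiMastropietro2006, §2.5 (2.49)] -/
theorem sectorPropagator_eq_fourier (e₀ μ : ℝ) (n : ℕ) (ω : ℤ) (x₀ : ℝ) (x : Fin 2 → ℝ) :
    sectorPropagator e₀ μ n ω x₀ x = 𝓕 (sectorSymbolE e₀ μ n ω) (dualPoint x₀ x) := by
  rw [Real.fourier_eq', sectorPropagator,
    ← measurePreserving_splitMomentum.integral_comp splitMomentum.measurableEmbedding]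
  refine integral_congr_ae (ae_of_all _ fun q => ?_)
  simp only [splitMomentum_apply, sectorSymbolE, smul_eq_mul, Matrix.cons_val_zero, Matrix.cons_val_one]
  congr 2
  rw [inner_E3]
  simp only [dualPoint, PiLp.toLp_apply, Matrix.cons_val_zero, Matrix.cons_val_one, Matrix.cons_val_two,
    Matrix.tail_cons, Matrix.head_cons]
  push_cast
  field_simp
  ring

/-! ### The anisotropic chart -/

section Chart

variable {μ : ℝ} (hμ₁ : -4 < μ) (hμ₂ : μ < -2 - Real.sqrt 2)
include hμ₁ hμ₂

omit hμ₁ hμ₂ in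
/-- The matrix of the chart `t ↦ (4^{-n}t₀, 4^{-n}t₁ n(θ₀) + 2^{-n}t₂ τ(θ₀))`. [cite: BenfattoGiulianiMastropietro2006, §2.5 Lemma 2.2] -/
def sectorChartMatrix (μ θ₀ : ℝ) (n : ℕ) : Matrix (Fin 3) (Fin 3) ℝ :=
  !![(4 : ℝ) ^ (-(n : ℤ)), 0, 0;
     0, (4 : ℝ) ^ (-(n : ℤ)) * fermiNormal μ θ₀ 0, (2 : ℝ) ^ (-(n : ℤ)) * fermiTangent μ θ₀ 0;
     0, (4 : ℝ) ^ (-(n : ℤ)) * fermiNormal μ θ₀ 1, (2 : ℝ) ^ (-(n : ℤ)) * fermiTangent μ θ₀ 1]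

/-- `det = 4^{-n}·4^{-n}·2^{-n}` (the frame is orthonormal and positively oriented). [cite: BenfattoGiulianiMastropietro2006, §2.5 Lemma 2.2] -/
theorem det_sectorChartMatrix (θ₀ : ℝ) (n : ℕ) :
    (sectorChartMatrix μ θ₀ n).det = (4 : ℝ) ^ (-(n : ℤ)) * (4 : ℝ) ^ (-(n : ℤ)) * (2 : ℝ) ^ (-(n : ℤ)) := by
  have hframe := det_fermiFrameMatrix hμ₁ hμ₂ θ₀
  rw [fermiFrameMatrix, Matrix.det_fin_two_of] at hframe
  rw [sectorChartMatrix, Matrix.det_fin_three]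
  simp only [Matrix.of_apply, Matrix.cons_val', Matrix.cons_val_zero, Matrix.cons_val_one,
    Matrix.cons_val_two, Matrix.empty_val', Matrix.cons_val_fin_one, Matrix.head_cons, Matrix.tail_cons,
    Matrix.head_fin_const]
  linear_combination ((4 : ℝ) ^ (-(n : ℤ)) * (4 : ℝ) ^ (-(n : ℤ)) * (2 : ℝ) ^ (-(n : ℤ))) * hframe

omit hμ₁ hμ₂ in
/-- The chart as a linear map of `ℝ³`. [folklore] -/
def sectorChartLin (μ θ₀ : ℝ) (n : ℕ) : MomSpace →ₗ[ℝ] MomSpace := Matrix.toEuclideanLin (sectorChartMatrix μ θ₀ n)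

/-- Its determinant. [folklore] -/
theorem det_sectorChartLin (θ₀ : ℝ) (n : ℕ) :
    LinearMap.det (sectorChartLin μ θ₀ n) = (4 : ℝ) ^ (-(n : ℤ)) * (4 : ℝ) ^ (-(n : ℤ)) * (2 : ℝ) ^ (-(n : ℤ)) := by
  rw [sectorChartLin, Matrix.toEuclideanLin, ← det_sectorChartMatrix hμ₁ hμ₂ θ₀ n]
  exact LinearMap.det_toLpLin 2 _

/-- The determinant is nonzero. [folklore] -/
theorem det_sectorChartLin_ne_zero (θ₀ : ℝ) (n : ℕ) : LinearMap.det (sectorChartLin μ θ₀ n) ≠ 0 := by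
  rw [det_sectorChartLin hμ₁ hμ₂]; positivity

/-- **The anisotropic chart** `t ↦ (4^{-n}t₀, 4^{-n}t₁ n(θ₀) + 2^{-n}t₂ τ(θ₀))` as a continuous
linear automorphism of `ℝ³`. [cite: BenfattoGiulianiMastropietro2006, §2.5 Lemma 2.2] -/
def sectorChart (θ₀ : ℝ) (n : ℕ) : MomSpace ≃L[ℝ] MomSpace :=
  (LinearMap.equivOfDetNeZero (sectorChartLin μ θ₀ n) (det_sectorChartLin_ne_zero hμ₁ hμ₂ θ₀ n)).toContinuousLinearEquiv

/-- The chart in coordinates. [folklore] -/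
theorem sectorChart_apply (θ₀ : ℝ) (n : ℕ) (t : MomSpace) :
    sectorChart hμ₁ hμ₂ θ₀ n t = WithLp.toLp 2
      ![(4 : ℝ) ^ (-(n : ℤ)) * t 0,
        (4 : ℝ) ^ (-(n : ℤ)) * fermiNormal μ θ₀ 0 * t 1 + (2 : ℝ) ^ (-(n : ℤ)) * fermiTangent μ θ₀ 0 * t 2,
        (4 : ℝ) ^ (-(n : ℤ)) * fermiNormal μ θ₀ 1 * t 1 + (2 : ℝ) ^ (-(n : ℤ)) * fermiTangent μ θ₀ 1 * t 2] := by
  change sectorChartLin μ θ₀ n t = _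
  rw [sectorChartLin, Matrix.toEuclideanLin, Matrix.toLpLin_apply]
  congr 1
  funext i
  fin_cases i <;> simp [sectorChartMatrix, Matrix.mulVec, dotProduct, Fin.sum_univ_three]

/-- Its determinant (through the underlying linear equivalence). [folklore] -/
theorem det_sectorChart (θ₀ : ℝ) (n : ℕ) :
    LinearMap.det ((sectorChart hμ₁ hμ₂ θ₀ n : MomSpace ≃ₗ[ℝ] MomSpace) : MomSpace →ₗ[ℝ] MomSpace) =
      (4 : ℝ) ^ (-(n : ℤ)) * (4 : ℝ) ^ (-(n : ℤ)) * (2 : ℝ) ^ (-(n : ℤ)) := by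
  rw [← det_sectorChartLin hμ₁ hμ₂ θ₀ n]
  rfl

/-- The determinant of the inverse chart. [folklore] -/
theorem det_sectorChart_symm (θ₀ : ℝ) (n : ℕ) :
    LinearMap.det (((sectorChart hμ₁ hμ₂ θ₀ n).symm : MomSpace ≃ₗ[ℝ] MomSpace) : MomSpace →ₗ[ℝ] MomSpace) =
      ((4 : ℝ) ^ (-(n : ℤ)) * (4 : ℝ) ^ (-(n : ℤ)) * (2 : ℝ) ^ (-(n : ℤ)))⁻¹ := by
  rw [← det_sectorChart hμ₁ hμ₂ θ₀ n]
  exact LinearEquiv.det_coe_symm _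

omit hμ₁ hμ₂ in
/-- **The adjoint of the chart** (the dual scales): `w ↦ (4^{-n}w₀, 4^{-n}⟨n, w⃗⟩, 2^{-n}⟨τ, w⃗⟩)`. [cite: BenfattoGiulianiMastropietro2006, §2.5 Lemma 2.2 (2.52)] -/
def sectorChartAdj (μ θ₀ : ℝ) (n : ℕ) (w : MomSpace) : MomSpace :=
  WithLp.toLp 2
    ![(4 : ℝ) ^ (-(n : ℤ)) * w 0,
      (4 : ℝ) ^ (-(n : ℤ)) * (fermiNormal μ θ₀ 0 * w 1 + fermiNormal μ θ₀ 1 * w 2),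
      (2 : ℝ) ^ (-(n : ℤ)) * (fermiTangent μ θ₀ 0 * w 1 + fermiTangent μ θ₀ 1 * w 2)]

/-- `sectorChartAdj` is the adjoint of `sectorChart`. [folklore] -/
theorem adjoint_sectorChart (θ₀ : ℝ) (n : ℕ) (w : MomSpace) :
    ContinuousLinearMap.adjoint (sectorChart hμ₁ hμ₂ θ₀ n : MomSpace →L[ℝ] MomSpace) w = sectorChartAdj μ θ₀ n w := by
  refine ext_inner_right ℝ fun t => ?_
  rw [ContinuousLinearMap.adjoint_inner_left, ContinuousLinearEquiv.coe_coe, sectorChart_apply, inner_E3,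
    inner_E3]
  simp only [sectorChartAdj, PiLp.toLp_apply, Matrix.cons_val_zero, Matrix.cons_val_one, Matrix.cons_val_two,
    Matrix.tail_cons, Matrix.head_cons]
  ring

end Chart

/-! ### The rescaled symbol and the decay transfer -/

section Transfer

variable {μ : ℝ} (hμ₁ : -4 < μ) (hμ₂ : μ < -2 - Real.sqrt 2)
include hμ₁ hμ₂

omit hμ₁ hμ₂ in
/-- The base point `q_F = (0, p_F(θ₀))` of the chart. [folklore] -/
def fermiBasePoint (μ θ₀ : ℝ) : MomSpace := WithLp.toLp 2 ![0, fermiX μ θ₀, fermiY μ θ₀]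

/-- **The rescaled sector symbol** `t ↦ sectorSymbolE(q_F + sectorChart t)` at
`θ₀ = θ_{h,ω} = (ω + ½) w_n`: in these coordinates the support is `O(1)` and (the content of the
remaining half of Lemma 2.2) all derivatives are `O(γ^{-h})` uniformly in `h`. [cite: BenfattoGiulianiMastropietro2006, §2.5 Lemma 2.2] -/
def rescaledSectorSymbol (e₀ : ℝ) (n : ℕ) (ω : ℤ) : MomSpace → ℂ := fun t =>
  sectorSymbolE e₀ μ n ω (fermiBasePoint μ (((ω : ℝ) + 1 / 2) * sectorWidth n) +
    sectorChart hμ₁ hμ₂ (((ω : ℝ) + 1 / 2) * sectorWidth n) n t)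

/-- The symbol is the rescaled symbol in the chart: `S(q) = R(A⁻¹(q - q_F))`. [folklore] -/
theorem sectorSymbolE_eq_comp (e₀ : ℝ) (n : ℕ) (ω : ℤ) :
    sectorSymbolE e₀ μ n ω =
      (rescaledSectorSymbol hμ₁ hμ₂ e₀ n ω ∘
          (sectorChart hμ₁ hμ₂ (((ω : ℝ) + 1 / 2) * sectorWidth n) n).symm) ∘
        fun q => q + -fermiBasePoint μ (((ω : ℝ) + 1 / 2) * sectorWidth n) := by
  funext q
  simp only [Function.comp_apply, rescaledSectorSymbol, ContinuousLinearEquiv.apply_symm_apply]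
  congr 1
  abel

omit hμ₁ hμ₂ in
/-- Translations act on the Fourier transform by a phase. [folklore] -/
theorem norm_fourier_comp_add_right (f : MomSpace → ℂ) (v₀ w : MomSpace) :
    ‖𝓕 (f ∘ fun v => v + v₀) w‖ = ‖𝓕 f w‖ := by
  have h := congrFun (VectorFourier.fourierIntegral_comp_add_right Real.fourierChar volume
    (innerₗ MomSpace) f v₀) w
  change ‖VectorFourier.fourierIntegral Real.fourierChar volume (innerₗ MomSpace) (f ∘ fun v => v + v₀) w‖ =
    ‖VectorFourier.fourierIntegral Real.fourierChar volume (innerₗ MomSpace) f w‖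
  rw [h, Circle.norm_smul]

/-- **Decay transfer (the change-of-variables half of Lemma 2.2).** If the rescaled symbol has
Fourier decay `‖𝓕 R(y)‖ ≤ K (1 + ‖y‖)^{-N}`, then for all `x₀, x⃗`,
`|g^{(h)}_ω(x₀, x⃗)| ≤ 4^{-n}4^{-n}2^{-n} · K · (1 + ‖A†ξ‖)^{-N}` with the dual point
`ξ = (x₀, -x⃗)/(2π)` and `A†ξ = (4^{-n}ξ₀, 4^{-n}⟨n, ξ⃗⟩, 2^{-n}⟨τ, ξ⃗⟩)` — i.e. size `γ^{5h/2}K`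
(`= γ^{3h/2}` for `K = O(γ^{-h})`) and decay on the scales `γ^{-h}` in `x₀` and `x'₁`, `γ^{-h/2}`
in `x'₂`, as in (2.52). [cite: BenfattoGiulianiMastropietro2006, §2.5 Lemma 2.2 (2.52)] -/
theorem norm_sectorPropagator_le_of_fourier_decay {e₀ : ℝ} {n : ℕ} {ω : ℤ} {K : ℝ} {N : ℕ}
    (hK : ∀ y, ‖𝓕 (rescaledSectorSymbol hμ₁ hμ₂ e₀ n ω) y‖ ≤ K * ((1 + ‖y‖) ^ N)⁻¹)
    (x₀ : ℝ) (x : Fin 2 → ℝ) :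
    ‖sectorPropagator e₀ μ n ω x₀ x‖ ≤
      ((4 : ℝ) ^ (-(n : ℤ)) * (4 : ℝ) ^ (-(n : ℤ)) * (2 : ℝ) ^ (-(n : ℤ))) *
        (K * ((1 + ‖sectorChartAdj μ (((ω : ℝ) + 1 / 2) * sectorWidth n) n (dualPoint x₀ x)‖) ^ N)⁻¹) := by
  set θ₀ : ℝ := ((ω : ℝ) + 1 / 2) * sectorWidth n with hθ₀
  set A := sectorChart hμ₁ hμ₂ θ₀ n with hA
  rw [sectorPropagator_eq_fourier, sectorSymbolE_eq_comp hμ₁ hμ₂, norm_fourier_comp_add_right]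
  have h := Literature.Analysis.Fourier.norm_fourier_comp_continuousLinearEquiv_le A.symm hK (dualPoint x₀ x)
  rw [ContinuousLinearEquiv.symm_symm, adjoint_sectorChart hμ₁ hμ₂] at h
  refine h.trans (le_of_eq ?_)
  -- `|det A⁻¹|⁻¹ = det A`
  have hdet := det_sectorChart_symm hμ₁ hμ₂ θ₀ n
  rw [← hA] at hdet
  have hpos : 0 < (4 : ℝ) ^ (-(n : ℤ)) * (4 : ℝ) ^ (-(n : ℤ)) * (2 : ℝ) ^ (-(n : ℤ)) := by positivity
  have key : |(LinearMap.det ((A.symm : MomSpace ≃ₗ[ℝ] MomSpace) : MomSpace →ₗ[ℝ] MomSpace))⁻¹| =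
      (4 : ℝ) ^ (-(n : ℤ)) * (4 : ℝ) ^ (-(n : ℤ)) * (2 : ℝ) ^ (-(n : ℤ)) := by
    rw [hdet, inv_inv, abs_of_pos hpos]
  exact congrArg₂ (· * ·) key rfl

end Transfer

end Literature.MathematicalPhysics.QuantumLattice

end
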